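import Literature.Geometry.Lorentzian.TeukolskyWhitingTransformODE
import Literature.Geometry.Lorentzian.OscillatoryHalfLine
import Literature.Geometry.Lorentzian.FarFieldODEChain
import HarnessLib

/-!
# The far-field part of Whiting's transform down to the real axis
# (Teixeira da Costa 2020, Lemma 3.10 / Lemma 3.12 at `y = 0`, Lemma 3.15)

Part of the proof programme for the named fact
`Literature.Geometry.Lorentzian.Kerr.Costa2019_realAxisModeStability` (R. Teixeira da Costa,
Commun. Math. Phys. 378 (2020) 705–781 = arXiv:1910.02854 [Costa2019], Thm. 4.1). For a radial
solution `R` (`s ≤ 0`, `2s ∈ ℤ`) outgoing at infinity, with amplitude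
`Φ = (r−r₋)^η (r−r₊)^ξ e^{−iωr} R` (`Costa2019.whitingAmplitude`), and a far-field multiplier
`α` (a symbol of integer degree vanishing on `(r₊, r₂]`, e.g. a cutoff times `(A(r−r₋))ʲ`), the
far piece `∫_{r₊}^∞ e^{A(z−r₋)(r−r₋)} α Φ dr` of the transform, absolutely convergent for
`yω > 0`, extends to `y = 0` (`Costa2019.far_package`): after `n` integrations by parts from
`r₁ ∈ (r₊, r₂)` (no boundary terms: the integrand vanishes identically near `r₁`;
`Costa2019.integral_Ioi_mul_exp_eq_ibp_iter`) the `n`-th derivative of `αΦ`, computed through the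
radial ODE as `W(ρₙ R + σₙ R')` with symbols `ρₙ, σₙ` (`Costa2019.exists_odeChain`), splits along
the outgoing expansion `R = P_N + E_N` (`Costa2019.outgoing_remainder_bounds`) into a symbol
(regularised by `Costa2019.IsInvSmooth.exists_halfLineRegularisation'`) plus an `O(r^{−4})`
remainder (absolutely convergent on the closed half-plane). The output is a function `Far(x, y)`
with its `x`-derivative `FarD(x, y)`: equal to the honest integrals for `yω > 0`, continuous in
`y` at `y = 0` from the side `yω ≥ 0`, differentiable in `x` at `y = 0`, continuous in `x` up to
`x = r₊`, and `O(x^{−n})` as `x → ∞` on `y = 0` (each integration by parts gains `1/(A(x−r₋))`,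
TdC Lemma 3.10: "`|∂ₓᵏ g̃(x)| ≤ C`", Lemma 3.15). Everything is proved; theorems only (D-0026).

## References
* R. Teixeira da Costa, CMP 378 (2020) 705–781, arXiv:1910.02854, Lemma 3.10, Lemma 3.12,
  Lemma 3.15, §3.2.3. [Costa2019]
-/

noncomputable section

open Complex Set MeasureTheory Filter Topology

namespace Literature.Geometry.Lorentzian.Kerr

namespace Costa2019

/-! ### More closure properties of `IsInvSmooth` -/

namespace IsInvSmooth

variable {r₁ : ℝ} {d : ℤ} {g g₁ g₂ : ℝ → ℂ}

/-- Raising the threshold. [folklore] -/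
theorem mono_left (hr₁ : 0 < r₁) (h : IsInvSmooth r₁ d g) {r₂ : ℝ} (h12 : r₁ ≤ r₂) :
    IsInvSmooth r₂ d g := by
  obtain ⟨G, hG, hg⟩ := h
  refine ⟨G, hG.mono (Icc_subset_Icc le_rfl (inv_anti₀ hr₁ h12)), fun r hr => hg r (h12.trans_lt hr)⟩

/-- Changing the function on `(−∞, r₁]` is harmless. [folklore] -/
theorem congr (h : IsInvSmooth r₁ d g₁) (heq : ∀ r, r₁ < r → g₂ r = g₁ r) : IsInvSmooth r₁ d g₂ := by
  obtain ⟨G, hG, hg⟩ := h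
  exact ⟨G, hG, fun r hr => (heq r hr).trans (hg r hr)⟩

/-- Rewriting the degree. [folklore] -/
theorem cast_degree {d' : ℤ} (h : IsInvSmooth r₁ d g) (e : d = d') : IsInvSmooth r₁ d' g := e ▸ h

/-- The zero function has every degree. [folklore] -/
theorem zero (r₁ : ℝ) (d : ℤ) : IsInvSmooth r₁ d (fun _ => 0) :=
  ⟨fun _ => 0, contDiffOn_const, fun r _ => by simp⟩

/-- Negation. [folklore] -/
theorem neg (h : IsInvSmooth r₁ d g) : IsInvSmooth r₁ d (fun r => -g r) := by
  have := h.const_mul (-1)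
  simpa using this

/-- Subtraction. [folklore] -/
theorem sub (h₁ : IsInvSmooth r₁ d g₁) (h₂ : IsInvSmooth r₁ d g₂) :
    IsInvSmooth r₁ d (fun r => g₁ r - g₂ r) := by
  have := h₁.add h₂.neg
  simpa [sub_eq_add_neg] using this

/-- Finite sums. [folklore] -/
theorem sum {ι : Type*} (S : Finset ι) {f : ι → ℝ → ℂ} (h : ∀ i ∈ S, IsInvSmooth r₁ d (f i)) :
    IsInvSmooth r₁ d (fun r => ∑ i ∈ S, f i r) := by
  classical
  induction S using Finset.induction_on with
  | empty => simpa using zero r₁ d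
  | insert i S hi ih =>
    have h1 := (h i (Finset.mem_insert_self i S)).add (ih fun j hj => h j (Finset.mem_insert_of_mem hj))
    refine h1.congr fun r _ => ?_
    rw [Finset.sum_insert hi]

/-- `r − c` (complex-valued) has degree `1`. [folklore] -/
theorem sub_const (hr₁ : 0 < r₁) (c : ℝ) : IsInvSmooth r₁ 1 (fun r => (r : ℂ) - c) := by
  refine ⟨fun u => ((1 - c * u : ℝ) : ℂ), ?_, fun r hr => ?_⟩
  · exact Complex.ofRealCLM.contDiff.comp_contDiffOn
      (contDiffOn_const.sub (contDiffOn_const.mul contDiffOn_id))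
  · have hr0 : (r : ℂ) ≠ 0 := by exact_mod_cast (hr₁.trans hr).ne'
    rw [zpow_one]
    push_cast
    field_simp

/-- Real casts: `r ↦ ((r − c : ℝ) : ℂ)`. [folklore] -/
theorem ofReal_sub_const (hr₁ : 0 < r₁) (c : ℝ) :
    IsInvSmooth r₁ 1 (fun r => ((r - c : ℝ) : ℂ)) :=
  (sub_const hr₁ c).congr fun r _ => by push_cast; ring

/-- `1/(r − c)` with the real cast inside. [folklore] -/
theorem inv_ofReal_sub (hr₁ : 0 < r₁) {c : ℝ} (hc : |c| < r₁) :
    IsInvSmooth r₁ (-1) (fun r => (((r - c : ℝ) : ℂ))⁻¹) :=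
  (inv_sub hr₁ hc).congr fun r _ => by push_cast; ring

end IsInvSmooth

/-! ### Sums of regularisations; a local chain rule -/

/-- **Sum of half-line regularisations** (for continuous, polynomially bounded integrands on
`[r₁, ∞)`, `r₁ ≥ 0`). [folklore] -/
theorem IsHalfLineRegularisation.add {r₁ C : ℝ} {k : ℕ} {g₁ g₂ : ℝ → ℂ} {F₁ F₁' F₂ F₂' : ℂ → ℂ}
    (hr₁ : 0 ≤ r₁) (h₁ : IsHalfLineRegularisation r₁ g₁ F₁ F₁')
    (h₂ : IsHalfLineRegularisation r₁ g₂ F₂ F₂')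
    (hg₁c : ContinuousOn g₁ (Ici r₁)) (hg₂c : ContinuousOn g₂ (Ici r₁))
    (hg₁b : ∀ r ∈ Ici r₁, ‖g₁ r‖ ≤ C * (1 + r) ^ k) (hg₂b : ∀ r ∈ Ici r₁, ‖g₂ r‖ ≤ C * (1 + r) ^ k) :
    IsHalfLineRegularisation r₁ (fun r => g₁ r + g₂ r) (fun lam => F₁ lam + F₂ lam)
      (fun lam => F₁' lam + F₂' lam) := by
  obtain ⟨a1, a1', b1, b1', c1, C1, d1⟩ := h₁
  obtain ⟨a2, a2', b2, b2', c2, C2, d2⟩ := h₂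
  have hC : 0 ≤ C := by
    have h := (norm_nonneg _).trans (hg₁b r₁ self_mem_Ici)
    have hp : 0 < (1 + r₁) ^ k := pow_pos (by linarith) k
    exact le_of_mul_le_mul_right (by simpa using h) hp
  -- integrability for `Re λ < 0`
  have hmulc : ∀ {g : ℝ → ℂ}, ContinuousOn g (Ici r₁) →
      ContinuousOn (fun r => g r * ((r - r₁ : ℝ) : ℂ)) (Ici r₁) := fun hg =>
    hg.mul (Complex.continuous_ofReal.comp (continuous_id.sub continuous_const)).continuousOn
  have hmulb : ∀ {g : ℝ → ℂ}, (∀ r ∈ Ici r₁, ‖g r‖ ≤ C * (1 + r) ^ k) →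
      ∀ r ∈ Ici r₁, ‖g r * ((r - r₁ : ℝ) : ℂ)‖ ≤ C * (1 + r) ^ (k + 1) := by
    intro g hg r hr
    have hr' : r₁ ≤ r := mem_Ici.1 hr
    rw [norm_mul, Complex.norm_real, Real.norm_eq_abs, abs_of_nonneg (sub_nonneg.2 hr'), pow_succ]
    have h1 := hg r hr
    have h2 : r - r₁ ≤ 1 + r := by linarith
    calc ‖g r‖ * (r - r₁) ≤ C * (1 + r) ^ k * (1 + r) :=
          mul_le_mul h1 h2 (sub_nonneg.2 hr') (mul_nonneg hC (pow_nonneg (by linarith) k))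
      _ = C * ((1 + r) ^ k * (1 + r)) := by ring
  refine ⟨fun lam hlam => ?_, fun lam hlam => ?_, b1.add b2, b1'.add b2',
    fun lam hlam => (c1 lam hlam).add (c2 lam hlam), ⟨C1 + C2, fun lam hlam h1 => ?_⟩⟩
  · beta_reduce
    rw [a1 lam hlam, a2 lam hlam, ← integral_add (integrableOn_mul_cexp_of_norm_le hlam hg₁c hg₁b)
      (integrableOn_mul_cexp_of_norm_le hlam hg₂c hg₂b)]
    refine integral_congr_ae (ae_of_all _ fun r => ?_)
    ring
  · beta_reduce
    rw [a1' lam hlam, a2' lam hlam, ← integral_add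
      (integrableOn_mul_cexp_of_norm_le hlam (hmulc hg₁c) (hmulb hg₁b))
      (integrableOn_mul_cexp_of_norm_le hlam (hmulc hg₂c) (hmulb hg₂b))]
    refine integral_congr_ae (ae_of_all _ fun r => ?_)
    ring
  · obtain ⟨e1, e1'⟩ := d1 lam hlam h1
    obtain ⟨e2, e2'⟩ := d2 lam hlam h1
    exact ⟨(norm_add_le _ _).trans (add_le_add e1 e2), (norm_add_le _ _).trans (add_le_add e1' e2')⟩

/-- **Local chain rule along an affine line.** If `F` has derivative `F'` within `S` at
`αx + β` and `αt + β ∈ S` for `t` near `x`, then `t ↦ F(αt + β)` has derivative `F' α` at `x`.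
[folklore] -/
theorem hasDerivAt_comp_affine_local {F : ℂ → ℂ} {F' α β : ℂ} {S : Set ℂ} {x : ℝ}
    (hF : HasDerivWithinAt F F' S (α * x + β)) (hS : ∀ᶠ t : ℝ in 𝓝 x, α * (t : ℂ) + β ∈ S) :
    HasDerivAt (fun t : ℝ => F (α * t + β)) (F' * α) x := by
  have h1 := (hF.hasFDerivWithinAt).restrictScalars ℝ
  have h2 : HasDerivAt (fun t : ℝ => α * t + β) α x := by
    have h0 : HasDerivAt (fun t : ℝ => (t : ℂ)) 1 x := by
      simpa using (hasDerivAt_id x).ofReal_comp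
    simpa using (h0.const_mul α).add_const β
  have h3 := h1.comp_hasDerivWithinAt x
    (h2.hasDerivWithinAt (s := {t : ℝ | α * t + β ∈ S})) fun t ht => ht
  have h4 : HasDerivAt (F ∘ fun t : ℝ => α * t + β)
      ((ContinuousLinearMap.restrictScalars ℝ
        (ContinuousLinearMap.smulRight (1 : ℂ →L[ℂ] ℂ) F')) α) x :=
    h3.hasDerivAt hS
  refine h4.congr_deriv ?_
  simp [mul_comm]

/-- A crude uniformisation of polynomial bounds: a function continuous on `[r₁, ∞)` (`r₁ ≥ 0`)
with `‖g(r)‖ ≤ C r^p` for `r ≥ X` (`p ≥ 0`) satisfies `‖g(r)‖ ≤ C' (1 + r)^k` on `[r₁, ∞)`.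
[folklore] -/
theorem exists_pow_bound_of_rpow_bound {g : ℝ → ℂ} {r₁ X C p : ℝ} (hr₁ : 0 ≤ r₁)
    (hgc : ContinuousOn g (Ici r₁)) (hb : ∀ r, X ≤ r → ‖g r‖ ≤ C * r ^ p) (hp : 0 ≤ p) :
    ∃ (C' : ℝ) (k : ℕ), 0 ≤ C' ∧ ∀ r ∈ Ici r₁, ‖g r‖ ≤ C' * (1 + r) ^ k := by
  obtain ⟨B, hB⟩ := (isCompact_Icc (a := r₁) (b := max X r₁)).exists_bound_of_continuousOn
    (hgc.mono Icc_subset_Ici_self)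
  refine ⟨|B| + |C|, ⌈p⌉₊, by positivity, fun r hr => ?_⟩
  have hr' : r₁ ≤ r := mem_Ici.1 hr
  have hr0 : 0 ≤ r := hr₁.trans hr'
  have h1r : 1 ≤ 1 + r := by linarith
  have hpow1 : 1 ≤ (1 + r) ^ ⌈p⌉₊ := one_le_pow₀ h1r
  rcases le_or_gt X r with hX | hX
  · have h1 := hb r hX
    have h2 : r ^ p ≤ (1 + r) ^ ⌈p⌉₊ := by
      calc r ^ p ≤ (1 + r) ^ p := Real.rpow_le_rpow hr0 (by linarith) hp
        _ ≤ (1 + r) ^ (⌈p⌉₊ : ℝ) := Real.rpow_le_rpow_of_exponent_le h1r (Nat.le_ceil p)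
        _ = (1 + r) ^ ⌈p⌉₊ := Real.rpow_natCast _ _
    calc ‖g r‖ ≤ C * r ^ p := h1
      _ ≤ |C| * r ^ p := mul_le_mul_of_nonneg_right (le_abs_self C) (Real.rpow_nonneg hr0 _)
      _ ≤ |C| * (1 + r) ^ ⌈p⌉₊ := mul_le_mul_of_nonneg_left h2 (abs_nonneg C)
      _ ≤ (|B| + |C|) * (1 + r) ^ ⌈p⌉₊ := by nlinarith [abs_nonneg B]
  · have h1 := hB r ⟨hr', hX.le.trans (le_max_left _ _)⟩
    calc ‖g r‖ ≤ B := h1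
      _ ≤ |B| * (1 + r) ^ ⌈p⌉₊ := (le_abs_self B).trans (le_mul_of_one_le_right (abs_nonneg B) hpow1)
      _ ≤ (|B| + |C|) * (1 + r) ^ ⌈p⌉₊ := by nlinarith [abs_nonneg C]

/-! ### The symbols of the problem: `W'/W`, the ODE coefficients, the inverted amplitude, the
partial sums of the outgoing expansion -/

/-- The logarithmic derivative `L = η/(r−r₋) + ξ/(r−r₊) − iω` of the amplitude weight
`W = (r−r₋)^η (r−r₊)^ξ e^{−iωr}`: `W' = W L` on `(r₊, ∞)`. [cite: Costa2019, §3.2 (def-g-tilde-sub)] -/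
theorem hasDerivAt_amplitudeWeight (M a ω m : ℝ) {r : ℝ} (hr : rPlus M a < r) :
    HasDerivAt (fun x : ℝ => ((x - rMinus M a : ℝ) : ℂ) ^ innerExponent M a ω m *
        ((x - rPlus M a : ℝ) : ℂ) ^ horizonExponent M a ω m * Complex.exp (-(I * ω * x)))
      ((((r - rMinus M a : ℝ) : ℂ) ^ innerExponent M a ω m *
        ((r - rPlus M a : ℝ) : ℂ) ^ horizonExponent M a ω m * Complex.exp (-(I * ω * r))) *
        (innerExponent M a ω m / ((r - rMinus M a : ℝ) : ℂ) +
          horizonExponent M a ω m / ((r - rPlus M a : ℝ) : ℂ) - I * ω)) r := by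
  have hq : rMinus M a < r := (rMinus_le_rPlus M a).trans_lt hr
  have hA := hasDerivAt_ofReal_sub_cpow (rMinus M a) (innerExponent M a ω m) hq
  have hB := hasDerivAt_ofReal_sub_cpow (rPlus M a) (horizonExponent M a ω m) hr
  have hE : HasDerivAt (fun x : ℝ => Complex.exp (-(I * ω * x)))
      (Complex.exp (-(I * ω * r)) * (-(I * ω))) r := by
    have h1 : HasDerivAt (fun x : ℝ => -(I * ω * (x : ℂ))) (-(I * ω * (1 : ℝ))) r :=
      ((hasDerivAt_id r).ofReal_comp.const_mul (I * ω)).neg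
    simpa using h1.cexp
  refine ((hA.mul hB).mul hE).congr_deriv ?_
  simp only [Pi.mul_apply]
  ring

/-- `L = η/(r−r₋) + ξ/(r−r₊) − iω` is a symbol of degree `0` beyond any `r₀ > r₊`. [folklore] -/
theorem isInvSmooth_logWeight {M a : ℝ} (hM : 0 < M) (ha : |a| < M) (ω m : ℝ) {r₀ : ℝ}
    (hr₀ : rPlus M a < r₀) :
    IsInvSmooth r₀ 0 (fun r => innerExponent M a ω m / ((r - rMinus M a : ℝ) : ℂ) +
      horizonExponent M a ω m / ((r - rPlus M a : ℝ) : ℂ) - I * ω) := by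
  have hrp : 0 < rPlus M a := rPlus_pos hM a
  have h0 : 0 < r₀ := hrp.trans hr₀
  have hcp : |rPlus M a| < r₀ := by rw [abs_of_pos hrp]; exact hr₀
  have hcm : |rMinus M a| < r₀ := by
    rw [abs_of_nonneg (IsSubextremal.rMinus_nonneg ha)]
    exact (rMinus_le_rPlus M a).trans_lt hr₀
  have h1 := ((IsInvSmooth.inv_ofReal_sub h0 hcm).const_mul (innerExponent M a ω m)).mono_degree h0
    (show (-1 : ℤ) ≤ 0 by norm_num)
  have h2 := ((IsInvSmooth.inv_ofReal_sub h0 hcp).const_mul (horizonExponent M a ω m)).mono_degree h0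
    (show (-1 : ℤ) ≤ 0 by norm_num)
  have h3 := (h1.add h2).sub (IsInvSmooth.const r₀ (I * ω))
  refine h3.congr fun r _ => ?_
  simp only [div_eq_mul_inv]

/-- `1/Δ = 1/((r−r₊)(r−r₋))` is a symbol of degree `−2` beyond any `r₀ > r₊`. [folklore] -/
theorem isInvSmooth_inv_delta {M a : ℝ} (hM : 0 < M) (ha : |a| < M) {r₀ : ℝ} (hr₀ : rPlus M a < r₀) :
    IsInvSmooth r₀ (-2) (fun r => ((delta M a r : ℝ) : ℂ)⁻¹) := by
  have hrp : 0 < rPlus M a := rPlus_pos hM a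
  have h0 : 0 < r₀ := hrp.trans hr₀
  have hcp : |rPlus M a| < r₀ := by rw [abs_of_pos hrp]; exact hr₀
  have hcm : |rMinus M a| < r₀ := by
    rw [abs_of_nonneg (IsSubextremal.rMinus_nonneg ha)]
    exact (rMinus_le_rPlus M a).trans_lt hr₀
  have h := (IsInvSmooth.inv_ofReal_sub h0 hcp).mul h0 (IsInvSmooth.inv_ofReal_sub h0 hcm)
  refine (h.cast_degree (by norm_num)).congr fun r _ => ?_
  rw [delta_eq_mul ha.le]
  push_cast
  rw [mul_inv]

/-- `K = ω(r² + a²) − am` (cast to `ℂ`) is a symbol of degree `2`. [folklore] -/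
theorem isInvSmooth_radialK {r₀ : ℝ} (hr₀ : 0 < r₀) (a ω m : ℝ) :
    IsInvSmooth r₀ 2 (fun r => ((radialK a ω m r : ℝ) : ℂ)) := by
  have h1 := ((IsInvSmooth.zpow r₀ 2).const_mul (ω : ℂ)).add
    ((IsInvSmooth.const r₀ ((ω * a ^ 2 - a * m : ℝ) : ℂ)).mono_degree hr₀ (by norm_num))
  refine h1.congr fun r _ => ?_
  unfold radialK
  push_cast
  simp only [zpow_two, sq]
  ring

/-- **The radial ODE in normal form with explicit symbol coefficients.** With
`p = −2(s+1)(r−M)/Δ` and `q = −V/Δ` (`V` the zeroth-order coefficient of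
`Kerr.IsRadialTeukolskySolution`), both symbols of degree `0` beyond any `r₀ > r₊`, every
classical radial solution satisfies `R'' = p R' + q R` on `(r₊, ∞)`.
[cite: Costa2019, §2.2.3] -/
theorem radial_normalForm_symbols {M a : ℝ} (hM : 0 < M) (ha : |a| < M) (s ω m lam : ℝ)
    {r₀ : ℝ} (hr₀ : rPlus M a < r₀) :
    ∃ p q : ℝ → ℂ, IsInvSmooth r₀ 0 p ∧ IsInvSmooth r₀ 0 q ∧
      ∀ R : ℝ → ℂ, IsRadialTeukolskySolution M a s ω m lam R →
        ∃ R' : ℝ → ℂ, ∀ r, rPlus M a < r →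
          HasDerivAt R (R' r) r ∧ HasDerivAt R' (p r * R' r + q r * R r) r := by
  have hrp : 0 < rPlus M a := rPlus_pos hM a
  have h0 : 0 < r₀ := hrp.trans hr₀
  set V : ℝ → ℂ := fun r =>
    (((radialK a ω m r ^ 2 : ℝ) : ℂ) -
          2 * I * (s : ℂ) * ((r - M : ℝ) : ℂ) * (radialK a ω m r : ℂ)) / (delta M a r : ℂ) +
        4 * I * (s : ℂ) * (ω : ℂ) * (r : ℂ) - (lam : ℂ) - ((a ^ 2 * ω ^ 2 : ℝ) : ℂ) +
      ((2 * a * m * ω : ℝ) : ℂ) with hV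
  set p : ℝ → ℂ := fun r => -(2 * ((s + 1 : ℝ) : ℂ) * ((r - M : ℝ) : ℂ)) / (delta M a r : ℂ)
    with hp
  set q : ℝ → ℂ := fun r => -V r / (delta M a r : ℂ) with hq
  have hΔ := isInvSmooth_inv_delta hM ha hr₀
  have hK := isInvSmooth_radialK h0 a ω m
  have hrM := IsInvSmooth.ofReal_sub_const h0 M
  -- `p`
  have hp_cl : IsInvSmooth r₀ 0 p := by
    have h1 := ((hrM.const_mul (-(2 * ((s + 1 : ℝ) : ℂ)))).mul h0 hΔ).mono_degree h0
      (show (1 : ℤ) + -2 ≤ 0 by norm_num)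
    refine h1.congr fun r _ => ?_
    simp only [hp, div_eq_mul_inv]; ring
  -- `V` has degree `2`
  have hV_cl : IsInvSmooth r₀ 2 V := by
    have t1 : IsInvSmooth r₀ 2 (fun r => (((radialK a ω m r ^ 2 : ℝ) : ℂ) -
        2 * I * (s : ℂ) * ((r - M : ℝ) : ℂ) * (radialK a ω m r : ℂ)) / (delta M a r : ℂ)) := by
      have hK2 : IsInvSmooth r₀ 4 (fun r => ((radialK a ω m r ^ 2 : ℝ) : ℂ)) :=
        ((hK.mul h0 hK).cast_degree (by norm_num)).congr fun r _ => by
          push_cast; ring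
      have hMK : IsInvSmooth r₀ 4 (fun r => 2 * I * (s : ℂ) * ((r - M : ℝ) : ℂ) * (radialK a ω m r : ℂ)) := by
        have := ((hrM.mul h0 hK).const_mul (2 * I * (s : ℂ))).mono_degree h0
          (show (1 : ℤ) + 2 ≤ 4 by norm_num)
        refine this.congr fun r _ => ?_; ring
      have := ((hK2.sub hMK).mul h0 hΔ)
      refine (this.cast_degree (by norm_num)).congr fun r _ => ?_
      simp only [div_eq_mul_inv]
    have t2 : IsInvSmooth r₀ 2 (fun r => 4 * I * (s : ℂ) * (ω : ℂ) * (r : ℂ) - (lam : ℂ) -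
        ((a ^ 2 * ω ^ 2 : ℝ) : ℂ) + ((2 * a * m * ω : ℝ) : ℂ)) := by
      have h1 := (((IsInvSmooth.zpow r₀ 1).const_mul (4 * I * (s : ℂ) * (ω : ℂ))).mono_degree h0
        (show (1 : ℤ) ≤ 2 by norm_num))
      have h2 := (IsInvSmooth.const r₀ (-(lam : ℂ) - ((a ^ 2 * ω ^ 2 : ℝ) : ℂ) +
        ((2 * a * m * ω : ℝ) : ℂ))).mono_degree h0 (show (0 : ℤ) ≤ 2 by norm_num)
      refine (h1.add h2).congr fun r _ => ?_
      rw [zpow_one]; ring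
    refine (t1.add t2).congr fun r _ => ?_
    simp only [hV]; ring
  have hq_cl : IsInvSmooth r₀ 0 q := by
    have := (hV_cl.mul h0 hΔ).neg
    refine (this.cast_degree (by norm_num)).congr fun r _ => ?_
    simp only [hq, div_eq_mul_inv]; ring
  refine ⟨p, q, hp_cl, hq_cl, fun R hsol => ?_⟩
  obtain ⟨R', R'', hR⟩ := hsol
  refine ⟨R', fun r hr => ?_⟩
  obtain ⟨hd1, hd2, hode⟩ := hR r hr
  have hΔne : (delta M a r : ℂ) ≠ 0 := by exact_mod_cast (delta_pos ha.le hr).ne'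
  have hp' : (delta M a r : ℂ) * p r = -(2 * ((s + 1 : ℝ) : ℂ) * ((r - M : ℝ) : ℂ)) := by
    simp only [hp]; field_simp
  have hq' : (delta M a r : ℂ) * q r = -V r := by
    simp only [hq]; field_simp
  have h1 : (delta M a r : ℂ) * (R'' r - (p r * R' r + q r * R r)) = 0 := by
    have e : (delta M a r : ℂ) * (R'' r - (p r * R' r + q r * R r)) =
        (delta M a r : ℂ) * R'' r - ((delta M a r : ℂ) * p r) * R' r -
          ((delta M a r : ℂ) * q r) * R r := by ring
    rw [e, hp', hq']
    simp only [hV]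
    linear_combination hode
  have heq : R'' r = p r * R' r + q r * R r := by
    rcases mul_eq_zero.1 h1 with h | h
    · exact absurd h hΔne
    · exact sub_eq_zero.1 h
  exact ⟨hd1, heq ▸ hd2⟩

/-- **The inverted amplitude is a symbol of degree `0`** beyond any `r₀ > r₊`:
`(r−r₋)^η (r−r₊)^ξ e^{−iωr} · e^{iωr + 2iMω log r} = (r−r₋)^η (r−r₊)^ξ r^{2iMω} = H(1/r)`,
`H(u) = (1 − r₋u)^η (1 − r₊u)^ξ` smooth on `[0, 1/r₀]`.
[cite: Costa2019, §3.2.3 (asymptotics of `g̃` for large `x`)] -/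
theorem isInvSmooth_weight_mul_phase {M a : ℝ} (hM : 0 < M) (ha : |a| < M) (ω m : ℝ) {r₀ : ℝ}
    (hr₀ : rPlus M a < r₀) :
    IsInvSmooth r₀ 0 (fun r => (((r - rMinus M a : ℝ) : ℂ) ^ innerExponent M a ω m *
        ((r - rPlus M a : ℝ) : ℂ) ^ horizonExponent M a ω m * Complex.exp (-(I * ω * r))) *
      outgoingPhase M ω r) := by
  have hrp : 0 < rPlus M a := rPlus_pos hM a
  have h0 : 0 < r₀ := hrp.trans hr₀
  have hrm : 0 ≤ rMinus M a := IsSubextremal.rMinus_nonneg ha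
  -- smoothness of `H` on `[0, 1/r₀]`
  have hsub : Icc (0 : ℝ) r₀⁻¹ ⊆ {u : ℝ | 0 < 1 - rPlus M a * u} := by
    intro u hu
    show 0 < 1 - rPlus M a * u
    have h2 : rPlus M a * u ≤ rPlus M a * r₀⁻¹ := mul_le_mul_of_nonneg_left hu.2 hrp.le
    have h3 : rPlus M a * r₀⁻¹ < 1 := by
      rw [← div_eq_mul_inv, div_lt_one h0]; exact hr₀
    linarith
  have hsub' : Icc (0 : ℝ) r₀⁻¹ ⊆ {u : ℝ | 0 < 1 - rMinus M a * u} := by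
    intro u hu
    show 0 < 1 - rMinus M a * u
    have h1 : rMinus M a * u ≤ rPlus M a * u := mul_le_mul_of_nonneg_right (rMinus_le_rPlus M a) hu.1
    have h2 : 0 < 1 - rPlus M a * u := hsub hu
    linarith
  have hH := ((contDiffOn_one_sub_mul_cpow (rMinus M a) (innerExponent M a ω m)).mono hsub').mul
    ((contDiffOn_one_sub_mul_cpow (rPlus M a) (horizonExponent M a ω m)).mono hsub)
  refine (IsInvSmooth.of_comp_inv hH).congr fun r hr => ?_
  have hrr : rPlus M a < r := hr₀.trans hr
  have hr00 : 0 < r := hrp.trans hrr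
  have hrc : (r : ℂ) ≠ 0 := by exact_mod_cast hr00.ne'
  -- `e^{−iωr} e^{iωr + 2iMω log r} = r^{2iMω}`
  have hphase : Complex.exp (-(I * ω * r)) * outgoingPhase M ω r = (r : ℂ) ^ (2 * I * M * ω) := by
    unfold outgoingPhase
    rw [← Complex.exp_add, Complex.cpow_def_of_ne_zero hrc, ← Complex.ofReal_log hr00.le]
    congr 1
    ring
  rw [show (((r - rMinus M a : ℝ) : ℂ) ^ innerExponent M a ω m *
        ((r - rPlus M a : ℝ) : ℂ) ^ horizonExponent M a ω m * Complex.exp (-(I * ω * r))) *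
      outgoingPhase M ω r =
      ((r - rMinus M a : ℝ) : ℂ) ^ innerExponent M a ω m *
        ((r - rPlus M a : ℝ) : ℂ) ^ horizonExponent M a ω m *
        (Complex.exp (-(I * ω * r)) * outgoingPhase M ω r) by ring, hphase]
  exact amplitude_inversion hM ha ω m hrr

/-- **The partial sums of the outgoing expansion are symbols** (`2s ∈ ℤ`): with `2s = k₀`,
`π_N = Σ cₖ r^{−2s−k−1}` has degree `−k₀ − 1` and `π_N'` degree `−k₀ − 2`, beyond any `r₀ > 0`.
[cite: Costa2019, Def. 2.3] -/
theorem isInvSmooth_outgoingSum {r₀ : ℝ} (hr₀ : 0 < r₀) {s : ℝ} {k₀ : ℤ} (hk₀ : 2 * s = k₀)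
    (c : ℕ → ℂ) (N : ℕ) :
    IsInvSmooth r₀ (-k₀ - 1) (outgoingSum s c N) ∧
      IsInvSmooth r₀ (-k₀ - 2) (outgoingSumDeriv s c N) := by
  have hcast : ∀ (k : ℕ) (j : ℕ) {r : ℝ}, 0 < r →
      ((r ^ (-(2 * s) - (k : ℝ) - j) : ℝ) : ℂ) = (r : ℂ) ^ (-k₀ - (k : ℤ) - (j : ℤ)) := by
    intro k j r hr
    have h1 : (-(2 * s) - (k : ℝ) - j : ℝ) = ((-k₀ - (k : ℤ) - (j : ℤ) : ℤ) : ℝ) := by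
      rw [hk₀]; push_cast; ring
    rw [h1, Real.rpow_intCast, Complex.ofReal_zpow]
  constructor
  · refine (IsInvSmooth.sum (Finset.range (N + 1)) (f := fun k r =>
      c k * (r : ℂ) ^ (-k₀ - (k : ℤ) - 1)) fun k _ => ?_).congr fun r hr => ?_
    · exact ((IsInvSmooth.zpow r₀ (-k₀ - (k : ℤ) - 1)).mono_degree hr₀ (by omega)).const_mul (c k)
    · unfold outgoingSum
      refine Finset.sum_congr rfl fun k _ => ?_
      have h1' := hcast k 1 (hr₀.trans hr)
      simp only [Nat.cast_one] at h1'
      rw [h1']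
  · refine (IsInvSmooth.sum (Finset.range (N + 1)) (f := fun k r =>
      c k * (((-(2 * s) - (k : ℝ) - 1 : ℝ) : ℂ) * (r : ℂ) ^ (-k₀ - (k : ℤ) - 2))) fun k _ => ?_).congr
      fun r hr => ?_
    · exact (((IsInvSmooth.zpow r₀ (-k₀ - (k : ℤ) - 2)).mono_degree (d' := -k₀ - 2) hr₀
        (by omega)).const_mul (((-(2 * s) - (k : ℝ) - 1 : ℝ) : ℂ))).const_mul (c k)
    · unfold outgoingSumDeriv
      refine Finset.sum_congr rfl fun k _ => ?_
      have h2 := hcast k 2 (hr₀.trans hr)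
      simp only [Nat.cast_ofNat] at h2
      rw [Complex.ofReal_mul, h2]

/-! ### The exponent `λ = A(z − r₋)` of the kernel -/

/-- Real and imaginary parts of `λ = A(x + iy − r₋)`, `A = 2iω/(r₊ − r₋)`:
`Re λ = −2ωy/(r₊−r₋)`, `Im λ = 2ω(x − r₋)/(r₊−r₋)`. [cite: Costa2019, §3.2.1] -/
theorem whitingA_mul_re_im {M a : ℝ} (ha : |a| < M) (ω x y : ℝ) :
    (whitingA M a ω * (((x : ℂ) + I * y) - rMinus M a)).re =
        -(2 * ω * y / (rPlus M a - rMinus M a)) ∧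
      (whitingA M a ω * (((x : ℂ) + I * y) - rMinus M a)).im =
        2 * ω * (x - rMinus M a) / (rPlus M a - rMinus M a) := by
  have hd : rPlus M a - rMinus M a ≠ 0 := (sub_pos.2 (IsSubextremal.rMinus_lt_rPlus ha)).ne'
  have hdc : ((rPlus M a - rMinus M a : ℝ) : ℂ) ≠ 0 := by exact_mod_cast hd
  have h : whitingA M a ω * (((x : ℂ) + I * y) - rMinus M a) =
      ((-(2 * ω * y / (rPlus M a - rMinus M a)) : ℝ) : ℂ) +
        ((2 * ω * (x - rMinus M a) / (rPlus M a - rMinus M a) : ℝ) : ℂ) * I := by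
    unfold whitingA
    push_cast
    field_simp
    ring_nf
    rw [Complex.I_sq]
    ring
  rw [h]
  refine ⟨?_, ?_⟩ <;>
    simp only [Complex.add_re, Complex.add_im, Complex.mul_re, Complex.mul_im, Complex.ofReal_re,
      Complex.ofReal_im, Complex.I_re, Complex.I_im] <;> ring

/-- `A ≠ 0` and `‖A‖ = 2|ω|/(r₊ − r₋)` (`ω ≠ 0`). [cite: Costa2019, §3.2 (def-g-tilde-sub)] -/
theorem whitingA_ne_zero_norm {M a : ℝ} (ha : |a| < M) {ω : ℝ} (hω : ω ≠ 0) :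
    whitingA M a ω ≠ 0 ∧ ‖whitingA M a ω‖ = 2 * |ω| / (rPlus M a - rMinus M a) := by
  have hd : 0 < rPlus M a - rMinus M a := sub_pos.2 (IsSubextremal.rMinus_lt_rPlus ha)
  have hdc : ((rPlus M a - rMinus M a : ℝ) : ℂ) ≠ 0 := by exact_mod_cast hd.ne'
  unfold whitingA
  refine ⟨?_, ?_⟩
  · refine div_ne_zero (mul_ne_zero (mul_ne_zero two_ne_zero Complex.I_ne_zero) ?_) hdc
    exact_mod_cast hω
  · rw [norm_div, norm_mul, norm_mul, Complex.norm_I, Complex.norm_real, Complex.norm_real,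
      Real.norm_eq_abs, Real.norm_eq_abs, abs_of_pos hd]
    norm_num

/-! ### The far package -/

set_option maxHeartbeats 1600000 in
/-- **The far-field part of Whiting's transform down to the real axis** (TdC Lemma 3.10 and
Lemma 3.12 at `y = 0`, Lemma 3.15 — the `(1 − χ)`-part). Let `R` be a classical radial
solution (`s ≤ 0`, `2s ∈ ℤ`, `ω ≠ 0`) outgoing at infinity, `Φ` its Whiting amplitude, and `α` a
symbol of degree `D` beyond `r₀ > r₊` vanishing on `(r₊, r₂]`, `r₀ < r₁ < r₂`. Then there are
functions `Far(x, y)`, `FarD(x, y)` such that: for `ωy > 0` they are the absolutely convergent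
far integrals `∫_{r₊}^∞ e^{A(z−r₋)(r−r₋)} αΦ` and `∫ e^{A(z−r₋)(r−r₋)} A(r−r₋) αΦ` (`z = x+iy`);
for `x > r₊` they are continuous in `y` at `0` from the side `ωy ≥ 0`; on `y = 0`, `Far(·,0)`
has `x`-derivative `FarD(·,0)` on `(r₊, ∞)`, is continuous on `[r₊, ∞)`, and
`‖Far(x,0)‖ ≤ C x^{−n}` for large `x` (after `n` integrations by parts).
[cite: Costa2019, Lemma 3.10, Lemma 3.12, Lemma 3.15] -/
theorem far_package {M a : ℝ} (hM : 0 < M) (ha : |a| < M) {s : ℝ} (hs : s ≤ 0)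
    {k₀ : ℤ} (hk₀ : 2 * s = k₀) {ω : ℝ} (hω : ω ≠ 0) {m lam : ℝ} {R : ℝ → ℂ}
    (hsol : IsRadialTeukolskySolution M a s ω m lam R) (hI : IsOutgoingAtInfinity M s ω R)
    {r₀ r₁ r₂ : ℝ} (hr₀ : rPlus M a < r₀) (hr₀₁ : r₀ < r₁) (hr₁₂ : r₁ < r₂)
    {D : ℤ} {α : ℝ → ℂ} (hα : IsInvSmooth r₀ D α)
    (hα0 : ∀ r, rPlus M a < r → r ≤ r₂ → α r = 0) (n : ℕ) :
    ∃ Far FarD : ℝ → ℝ → ℂ,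
      (∀ x y, 0 < ω * y →
        Far x y = whitingTransform M a ω (fun r => α r * whitingAmplitude M a ω m R r)
          ((x : ℂ) + I * y)) ∧
      (∀ x y, 0 < ω * y →
        FarD x y = ∫ r in Ioi (rPlus M a), whitingKernel M a ω ((x : ℂ) + I * y) r *
          (whitingA M a ω * ((r - rMinus M a : ℝ) : ℂ)) * (α r * whitingAmplitude M a ω m R r)) ∧
      (∀ x, rPlus M a < x →
        ContinuousWithinAt (fun y => Far x y) {y | 0 ≤ ω * y} 0 ∧
        ContinuousWithinAt (fun y => FarD x y) {y | 0 ≤ ω * y} 0) ∧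
      (∀ x, rPlus M a < x → HasDerivAt (fun x => Far x 0) (FarD x 0) x) ∧
      ContinuousOn (fun x => Far x 0) (Ici (rPlus M a)) ∧
      ∃ C X : ℝ, ∀ x, X ≤ x → ‖Far x 0‖ ≤ C * x ^ (-(n : ℝ)) := by
  -- constants
  have hrp : 0 < rPlus M a := rPlus_pos hM a
  have h0 : 0 < r₀ := hrp.trans hr₀
  have hr₁p : rPlus M a < r₁ := hr₀.trans hr₀₁
  have hr₁0 : 0 < r₁ := hrp.trans hr₁p
  have hgap : 0 < rPlus M a - rMinus M a := sub_pos.2 (IsSubextremal.rMinus_lt_rPlus ha)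
  have hrm0 : 0 ≤ rMinus M a := IsSubextremal.rMinus_nonneg ha
  obtain ⟨hA0, hAn⟩ := whitingA_ne_zero_norm ha hω
  -- the weight `W` and its logarithmic derivative
  set W : ℝ → ℂ := fun r => ((r - rMinus M a : ℝ) : ℂ) ^ innerExponent M a ω m *
      ((r - rPlus M a : ℝ) : ℂ) ^ horizonExponent M a ω m * Complex.exp (-(I * ω * r)) with hW
  set L : ℝ → ℂ := fun r => innerExponent M a ω m / ((r - rMinus M a : ℝ) : ℂ) +
      horizonExponent M a ω m / ((r - rPlus M a : ℝ) : ℂ) - I * ω with hL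
  have hWd : ∀ r, r₀ < r → HasDerivAt W (W r * L r) r := fun r hr =>
    hasDerivAt_amplitudeWeight M a ω m (hr₀.trans hr)
  have hWn : ∀ r, rPlus M a < r → ‖W r‖ = 1 := fun r hr => norm_amplitudePrefactor M a ω m hr
  have hΦW : ∀ r, whitingAmplitude M a ω m R r = W r * R r := fun r => rfl
  have hLc : IsInvSmooth r₀ 0 L := isInvSmooth_logWeight hM ha ω m hr₀
  have hWc : ContinuousOn W (Ioi (rPlus M a)) := fun r hr =>
    (hasDerivAt_amplitudeWeight M a ω m hr).continuousAt.continuousWithinAt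
  -- the ODE `R'' = p R' + q R`
  obtain ⟨p, q, hpc, hqc, hpq⟩ := radial_normalForm_symbols hM ha s ω m lam hr₀
  obtain ⟨R', hRd⟩ := hpq R hsol
  have hRc : ContinuousOn R (Ioi (rPlus M a)) := fun r hr =>
    (hRd r hr).1.continuousAt.continuousWithinAt
  have hR'c : ContinuousOn R' (Ioi (rPlus M a)) := fun r hr =>
    (hRd r hr).2.continuousAt.continuousWithinAt
  have hderivR : ∀ r, rPlus M a < r → deriv R r = R' r := fun r hr => (hRd r hr).1.deriv
  have hsub₀ : Ioi r₀ ⊆ Ioi (rPlus M a) := fun r hr => hr₀.trans hr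
  -- the ODE chain
  obtain ⟨ρ, σ, hρ0, hσ0, hcl, hder⟩ := exists_odeChain h0 hWd hLc hpc hqc
    (fun r hr => (hRd r (hr₀.trans hr)).1) (fun r hr => (hRd r (hr₀.trans hr)).2)
    hα (IsInvSmooth.zero r₀ D) n
  set f : ℕ → ℝ → ℂ := fun j r => W r * (ρ j r * R r + σ j r * R' r) with hf
  have hfd : ∀ j, j < n → ∀ r, r₀ < r → HasDerivAt (f j) (f (j + 1) r) r :=
    fun j hj r hr => hder j hj r hr
  have hf0 : ∀ r, f 0 r = α r * whitingAmplitude M a ω m R r := by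
    intro r; simp only [hf, hρ0, hσ0, hΦW]; ring
  have hfc : ∀ j, j ≤ n → ContinuousOn (f j) (Ioi r₀) := by
    intro j hj
    obtain ⟨hρj, hσj⟩ := hcl j hj
    exact (hWc.mono hsub₀).mul (((hρj.continuousOn h0).mul (hRc.mono hsub₀)).add
      ((hσj.continuousOn h0).mul (hR'c.mono hsub₀)))
  -- the chain vanishes identically on `(r₀, r₂)`
  have hfz : ∀ j, j ≤ n → ∀ r ∈ Ioo r₀ r₂, f j r = 0 := by
    intro j
    induction j with
    | zero => intro _ r hr; rw [hf0, hα0 r (hr₀.trans hr.1) hr.2.le, zero_mul]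
    | succ j ih =>
      intro hj r hr
      have hj' : j < n := Nat.lt_of_succ_le hj
      have hloc : f j =ᶠ[𝓝 r] fun _ => (0 : ℂ) := by
        filter_upwards [isOpen_Ioo.mem_nhds hr] with x hx using ih hj'.le x hx
      have h1 : HasDerivAt (f j) 0 r := (hasDerivAt_const r (0 : ℂ)).congr_of_eventuallyEq hloc
      exact (hfd j hj' r hr.1).unique h1
  -- polynomial bounds on `[r₁, ∞)`
  obtain ⟨X₀, CR, pR, hX₀, hX₀1, hCR, hpR, hgrow⟩ :=
    exists_rpow_bound_of_isRadialTeukolskySolution hM ha hω hsol fun r hr => (hRd r hr).1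
  have hfb1 : ∀ j, j ≤ n → ∃ (C' : ℝ) (k : ℕ), 0 ≤ C' ∧
      ∀ r ∈ Ici r₁, ‖f j r‖ ≤ C' * (1 + r) ^ k := by
    intro j hj
    obtain ⟨hρj, hσj⟩ := hcl j hj
    obtain ⟨Cρ, hCρ⟩ := hρj.norm_le h0
    obtain ⟨Cσ, hCσ⟩ := hσj.norm_le h0
    set X₁ : ℝ := max X₀ (max 1 (r₀ + 1)) with hX₁
    have hb : ∀ r, X₁ ≤ r → ‖f j r‖ ≤ (|Cρ| + |Cσ|) * CR * r ^ ((D.toNat : ℝ) + pR) := by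
      intro r hr
      have hrX : X₀ ≤ r := (le_max_left _ _).trans hr
      have hr1 : 1 ≤ r := ((le_max_left _ _).trans (le_max_right _ _)).trans hr
      have hrr₀ : r₀ < r := by
        have := ((le_max_right _ _).trans (le_max_right _ _)).trans hr; linarith
      have hrp' : rPlus M a < r := hr₀.trans hrr₀
      have hr0 : 0 < r := by linarith
      obtain ⟨hRb, hR'b⟩ := hgrow r hrX
      have hDT : r ^ D ≤ r ^ ((D.toNat : ℝ)) := by
        calc r ^ D ≤ r ^ (D.toNat : ℤ) := zpow_le_zpow_right₀ hr1 (Int.self_le_toNat D)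
          _ = r ^ ((D.toNat : ℝ)) := by rw [zpow_natCast, Real.rpow_natCast]
      have hzD : 0 ≤ r ^ D := zpow_nonneg hr0.le _
      have hrpow : r ^ ((D.toNat : ℝ)) * r ^ pR = r ^ ((D.toNat : ℝ) + pR) :=
        (Real.rpow_add hr0 _ _).symm
      have hCRp : 0 ≤ CR * r ^ pR := mul_nonneg hCR (Real.rpow_nonneg hr0.le _)
      simp only [hf]
      rw [norm_mul, hWn r hrp', one_mul]
      calc ‖ρ j r * R r + σ j r * R' r‖ ≤ ‖ρ j r‖ * ‖R r‖ + ‖σ j r‖ * ‖R' r‖ := by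
            refine (norm_add_le _ _).trans ?_; rw [norm_mul, norm_mul]
        _ ≤ (|Cρ| * r ^ D) * (CR * r ^ pR) + (|Cσ| * r ^ D) * (CR * r ^ pR) :=
            add_le_add
              (mul_le_mul ((hCρ r hrr₀).trans (mul_le_mul_of_nonneg_right (le_abs_self _) hzD))
                hRb (norm_nonneg _) (by positivity))
              (mul_le_mul ((hCσ r hrr₀).trans (mul_le_mul_of_nonneg_right (le_abs_self _) hzD))
                hR'b (norm_nonneg _) (by positivity))
        _ = (|Cρ| + |Cσ|) * (r ^ D * (CR * r ^ pR)) := by ring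
        _ ≤ (|Cρ| + |Cσ|) * (r ^ ((D.toNat : ℝ)) * (CR * r ^ pR)) :=
            mul_le_mul_of_nonneg_left (mul_le_mul_of_nonneg_right hDT hCRp) (by positivity)
        _ = (|Cρ| + |Cσ|) * CR * (r ^ ((D.toNat : ℝ)) * r ^ pR) := by ring
        _ = (|Cρ| + |Cσ|) * CR * r ^ ((D.toNat : ℝ) + pR) := by rw [hrpow]
    exact exists_pow_bound_of_rpow_bound hr₁0.le ((hfc j hj).mono fun r hr => hr₀₁.trans_le hr) hb
      (add_nonneg (Nat.cast_nonneg _) hpR)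
  have hfb : ∃ (C' : ℝ) (k : ℕ), 0 ≤ C' ∧
      ∀ j, j ≤ n → ∀ r ∈ Ici r₁, ‖f j r‖ ≤ C' * (1 + r) ^ k := by
    have key : ∀ n', n' ≤ n → ∃ (C' : ℝ) (k : ℕ), 0 ≤ C' ∧
        ∀ j, j ≤ n' → ∀ r ∈ Ici r₁, ‖f j r‖ ≤ C' * (1 + r) ^ k := by
      intro n'
      induction n' with
      | zero =>
        intro hn
        obtain ⟨C', k, hC', hCk⟩ := hfb1 0 hn
        exact ⟨C', k, hC', fun j hj => by rw [Nat.le_zero.1 hj]; exact hCk⟩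
      | succ n' ih =>
        intro hn
        obtain ⟨C₁, k₁, hC₁, h₁⟩ := ih (Nat.le_of_succ_le hn)
        obtain ⟨C₂, k₂, hC₂, h₂⟩ := hfb1 (n' + 1) hn
        refine ⟨C₁ + C₂, max k₁ k₂, by positivity, fun j hj r hr => ?_⟩
        have hr' : r₁ ≤ r := mem_Ici.1 hr
        have h1r : 1 ≤ 1 + r := by linarith
        have hk₁ : (1 + r) ^ k₁ ≤ (1 + r) ^ max k₁ k₂ := pow_le_pow_right₀ h1r (le_max_left _ _)
        have hk₂ : (1 + r) ^ k₂ ≤ (1 + r) ^ max k₁ k₂ := pow_le_pow_right₀ h1r (le_max_right _ _)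
        have hpos : 0 ≤ (1 + r) ^ max k₁ k₂ := pow_nonneg (by linarith) _
        rcases Nat.lt_succ_iff_lt_or_eq.1 (Nat.lt_succ_of_le hj) with hlt | heq
        · have := h₁ j (Nat.lt_succ_iff.1 hlt) r hr
          calc ‖f j r‖ ≤ C₁ * (1 + r) ^ k₁ := this
            _ ≤ C₁ * (1 + r) ^ max k₁ k₂ := mul_le_mul_of_nonneg_left hk₁ hC₁
            _ ≤ (C₁ + C₂) * (1 + r) ^ max k₁ k₂ := by nlinarith
        · rw [heq]
          have := h₂ r hr
          calc ‖f (n' + 1) r‖ ≤ C₂ * (1 + r) ^ k₂ := this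
            _ ≤ C₂ * (1 + r) ^ max k₁ k₂ := mul_le_mul_of_nonneg_left hk₂ hC₂
            _ ≤ (C₁ + C₂) * (1 + r) ^ max k₁ k₂ := by nlinarith
    exact key n le_rfl
  obtain ⟨Cf, kf, hCf0, hCf⟩ := hfb
  -- the amplitude `Ψ = α Φ = f 0`: continuity and polynomial bound on `(r₊, ∞)`
  set Ψ : ℝ → ℂ := fun r => α r * whitingAmplitude M a ω m R r with hΨ
  have hΨz : ∀ r, rPlus M a < r → r ≤ r₂ → Ψ r = 0 := fun r hr hr2 => by
    simp only [hΨ, hα0 r hr hr2, zero_mul]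
  have hΨc : ContinuousOn Ψ (Ioi (rPlus M a)) := by
    intro r hr
    have hr' : rPlus M a < r := hr
    rcases lt_or_ge r r₂ with h | h
    · have hloc : Ψ =ᶠ[𝓝 r] fun _ => (0 : ℂ) := by
        filter_upwards [isOpen_Ioo.mem_nhds (show r ∈ Ioo (rPlus M a) r₂ from ⟨hr', h⟩)] with x hx
          using hΨz x hx.1 hx.2.le
      exact (continuousAt_const.congr_of_eventuallyEq hloc).continuousWithinAt
    · have hrr₀ : r₀ < r := by linarith
      have h1 : ContinuousAt (f 0) r := (hfc 0 (Nat.zero_le n)).continuousAt (Ioi_mem_nhds hrr₀)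
      have h2 : f 0 = Ψ := funext fun x => hf0 x
      rw [h2] at h1
      exact h1.continuousWithinAt
  have hΨb : ∀ r, rPlus M a < r → ‖Ψ r‖ ≤ Cf * (1 + r) ^ kf := by
    intro r hr
    rcases lt_or_ge r r₁ with h | h
    · rw [hΨz r hr (by linarith), norm_zero]
      exact mul_nonneg hCf0 (pow_nonneg (by linarith [hrp.trans hr]) _)
    · rw [show Ψ r = f 0 r from (hf0 r).symm]; exact hCf 0 (Nat.zero_le n) r h
  -- the outgoing expansion and the choice of `N`
  obtain ⟨c, hc⟩ := hI
  obtain ⟨K₀, hK₀, hrem⟩ := outgoing_remainder_bounds hM ha hs hω hsol (c := c) hc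
  set T : ℕ := D.toNat with hT
  set N : ℕ := ⌈K₀ - 2 * s⌉₊ + 2 * T + 6 with hN
  have hN1 : 1 ≤ N := by omega
  have hNR : K₀ - 2 * s + 2 * T + 6 ≤ (N : ℝ) := by
    have h1 : K₀ - 2 * s ≤ (⌈K₀ - 2 * s⌉₊ : ℝ) := Nat.le_ceil _
    rw [hN]; push_cast; linarith
  have hT0 : (0 : ℝ) ≤ T := Nat.cast_nonneg T
  have hNs : -(2 * s) ≤ (N : ℝ) := by linarith
  obtain ⟨XN, CN, hXN, hXN1, hEN⟩ := hrem N hN1 hNs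
  set e₁ : ℝ := -(2 * s) - (N : ℝ) - 2 with he₁
  set e₂ : ℝ := (-(2 * s) - (N : ℝ) - 2 + K₀) / 2 with he₂
  have he₁le : (T : ℝ) + e₁ ≤ ((-4 : ℤ) : ℝ) := by push_cast; rw [he₁]; linarith
  have he₂le : (T : ℝ) + e₂ ≤ ((-4 : ℤ) : ℝ) := by push_cast; rw [he₂]; linarith
  -- the main part `gm` of `f n` and the error `ge`
  set 𝔥 : ℝ → ℂ := fun r => W r * outgoingPhase M ω r with h𝔥
  have h𝔥c : IsInvSmooth r₀ 0 𝔥 := isInvSmooth_weight_mul_phase hM ha ω m hr₀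
  obtain ⟨hπ, hπ'⟩ := isInvSmooth_outgoingSum h0 hk₀ c N
  set θ : ℝ → ℂ := fun r => I * ω + 2 * I * M * ω * (r : ℂ)⁻¹ with hθ
  have hθc : IsInvSmooth r₀ 0 θ := by
    have := (IsInvSmooth.const r₀ (I * ω)).add
      (((IsInvSmooth.zpow r₀ (-1)).const_mul (2 * I * M * ω)).mono_degree h0 (by norm_num))
    refine this.congr fun r _ => ?_
    simp only [hθ, zpow_neg, zpow_one]
  obtain ⟨hρn, hσn⟩ := hcl n le_rfl
  set gm : ℝ → ℂ := fun r => 𝔥 r * (ρ n r * outgoingSum s c N r +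
      σ n r * (θ r * outgoingSum s c N r + outgoingSumDeriv s c N r)) with hgm
  have hgmc : IsInvSmooth r₀ (D + (-k₀ - 1)) gm := by
    have hπ₀ : IsInvSmooth r₀ (-k₀ - 1) (outgoingSumDeriv s c N) := hπ'.mono_degree h0 (by omega)
    have h1 : IsInvSmooth r₀ (-k₀ - 1)
        (fun r => θ r * outgoingSum s c N r + outgoingSumDeriv s c N r) :=
      ((hθc.mul h0 hπ).cast_degree (by ring)).add hπ₀
    have h2 := (hρn.mul h0 hπ).add (hσn.mul h0 h1)
    exact ((h𝔥c.mul h0 h2).cast_degree (by ring)).congr fun r _ => by simp only [hgm]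
  set ge : ℝ → ℂ := fun r => f n r - gm r with hge
  have hge_eq : ∀ r, ge r = W r * (ρ n r * (R r - outgoingP M s ω c N r) +
      σ n r * (R' r - outgoingPDeriv M s ω c N r)) := by
    intro r
    simp only [hge, hgm, hf, h𝔥, hθ, outgoingP, outgoingPDeriv]
    ring
  have hgec : ContinuousOn ge (Ioi r₀) := (hfc n le_rfl).sub (hgmc.continuousOn h0)
  -- size of `ge`: `O(r^{−4})` beyond `r₀'' = (r₀ + r₁)/2`
  set r₀'' : ℝ := (r₀ + r₁) / 2 with hr₀''
  have hr₀''₀ : r₀ < r₀'' := by rw [hr₀'']; linarith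
  have hr₀''₁ : r₀'' < r₁ := by rw [hr₀'']; linarith
  have h0'' : 0 < r₀'' := h0.trans hr₀''₀
  obtain ⟨Cρ, hCρ⟩ := hρn.norm_le h0
  obtain ⟨Cσ, hCσ⟩ := hσn.norm_le h0
  set X₂ : ℝ := max XN (max 1 (r₀ + 1)) with hX₂
  have hX₂1 : 1 ≤ X₂ := (le_max_left _ _).trans (le_max_right _ _)
  have hge_far : ∀ r, X₂ ≤ r → ‖ge r‖ ≤ (|Cρ| + |Cσ|) * |CN| * r ^ (-4 : ℤ) := by
    intro r hr
    have hrN : XN ≤ r := (le_max_left _ _).trans hr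
    have hr1 : 1 ≤ r := hX₂1.trans hr
    have hrr₀ : r₀ < r := by
      have := ((le_max_right _ _).trans (le_max_right _ _)).trans hr; linarith
    have hrp' : rPlus M a < r := hr₀.trans hrr₀
    have hr0 : 0 < r := by linarith
    obtain ⟨hE, hE'⟩ := hEN r hrN
    rw [hderivR r hrp'] at hE'
    rw [hge_eq r, norm_mul, hWn r hrp', one_mul]
    have hzD : 0 ≤ r ^ D := zpow_nonneg hr0.le _
    have hρb : ‖ρ n r‖ ≤ |Cρ| * r ^ D :=
      (hCρ r hrr₀).trans (mul_le_mul_of_nonneg_right (le_abs_self _) hzD)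
    have hσb : ‖σ n r‖ ≤ |Cσ| * r ^ D :=
      (hCσ r hrr₀).trans (mul_le_mul_of_nonneg_right (le_abs_self _) hzD)
    have hEb : ‖R r - outgoingP M s ω c N r‖ ≤ |CN| * r ^ e₁ :=
      hE.trans (mul_le_mul_of_nonneg_right (le_abs_self _) (Real.rpow_nonneg hr0.le _))
    have hE'b : ‖R' r - outgoingPDeriv M s ω c N r‖ ≤ |CN| * r ^ e₂ :=
      hE'.trans (mul_le_mul_of_nonneg_right (le_abs_self _) (Real.rpow_nonneg hr0.le _))
    have hDT : r ^ D ≤ r ^ ((T : ℝ)) := by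
      calc r ^ D ≤ r ^ (T : ℤ) := zpow_le_zpow_right₀ hr1 (Int.self_le_toNat D)
        _ = r ^ ((T : ℝ)) := by rw [zpow_natCast, Real.rpow_natCast]
    have key : ∀ e : ℝ, (T : ℝ) + e ≤ ((-4 : ℤ) : ℝ) → r ^ D * r ^ e ≤ r ^ (-4 : ℤ) := by
      intro e he
      calc r ^ D * r ^ e ≤ r ^ ((T : ℝ)) * r ^ e :=
            mul_le_mul_of_nonneg_right hDT (Real.rpow_nonneg hr0.le _)
        _ = r ^ ((T : ℝ) + e) := (Real.rpow_add hr0 _ _).symm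
        _ ≤ r ^ ((-4 : ℤ) : ℝ) := Real.rpow_le_rpow_of_exponent_le hr1 he
        _ = r ^ (-4 : ℤ) := Real.rpow_intCast r (-4)
    calc ‖ρ n r * (R r - outgoingP M s ω c N r) + σ n r * (R' r - outgoingPDeriv M s ω c N r)‖ ≤
        ‖ρ n r‖ * ‖R r - outgoingP M s ω c N r‖ +
          ‖σ n r‖ * ‖R' r - outgoingPDeriv M s ω c N r‖ := by
          refine (norm_add_le _ _).trans ?_; rw [norm_mul, norm_mul]
      _ ≤ (|Cρ| * r ^ D) * (|CN| * r ^ e₁) + (|Cσ| * r ^ D) * (|CN| * r ^ e₂) :=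
          add_le_add (mul_le_mul hρb hEb (norm_nonneg _) (by positivity))
            (mul_le_mul hσb hE'b (norm_nonneg _) (by positivity))
      _ = |Cρ| * |CN| * (r ^ D * r ^ e₁) + |Cσ| * |CN| * (r ^ D * r ^ e₂) := by ring
      _ ≤ |Cρ| * |CN| * r ^ (-4 : ℤ) + |Cσ| * |CN| * r ^ (-4 : ℤ) :=
          add_le_add (mul_le_mul_of_nonneg_left (key e₁ he₁le) (by positivity))
            (mul_le_mul_of_nonneg_left (key e₂ he₂le) (by positivity))
      _ = (|Cρ| + |Cσ|) * |CN| * r ^ (-4 : ℤ) := by ring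
  obtain ⟨B, hB⟩ := (isCompact_Icc (a := r₀'') (b := X₂)).exists_bound_of_continuousOn
    (hgec.mono fun r hr => hr₀''₀.trans_le hr.1)
  set Ce : ℝ := (|Cρ| + |Cσ|) * |CN| + |B| * X₂ ^ 4 with hCe
  have hCe0 : 0 ≤ Ce := by rw [hCe]; positivity
  have hge_bd : ∀ r, r₀'' < r → ‖ge r‖ ≤ Ce * r ^ (-4 : ℤ) := by
    intro r hr
    have hr0 : 0 < r := h0''.trans hr
    have hz : 0 < r ^ (-4 : ℤ) := zpow_pos hr0 _
    have hX4 : 0 ≤ X₂ ^ 4 := by positivity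
    have hsum0 : 0 ≤ (|Cρ| + |Cσ|) * |CN| := by positivity
    rcases le_or_gt X₂ r with h | h
    · calc ‖ge r‖ ≤ (|Cρ| + |Cσ|) * |CN| * r ^ (-4 : ℤ) := hge_far r h
        _ ≤ Ce * r ^ (-4 : ℤ) := by
            rw [hCe]
            nlinarith [mul_nonneg (mul_nonneg (abs_nonneg B) hX4) hz.le]
    · have h1 := hB r ⟨hr.le, h.le⟩
      have h2 : 1 ≤ X₂ ^ 4 * r ^ (-4 : ℤ) := by
        rw [zpow_neg, zpow_ofNat, ← div_eq_mul_inv, le_div_iff₀ (pow_pos hr0 4), one_mul]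
        exact pow_le_pow_left₀ hr0.le h.le 4
      calc ‖ge r‖ ≤ B := h1
        _ ≤ |B| * (X₂ ^ 4 * r ^ (-4 : ℤ)) :=
            (le_abs_self B).trans (le_mul_of_one_le_right (abs_nonneg B) h2)
        _ = |B| * X₂ ^ 4 * r ^ (-4 : ℤ) := by ring
        _ ≤ Ce * r ^ (-4 : ℤ) := by
            rw [hCe]
            nlinarith [mul_nonneg hsum0 hz.le]
  -- regularisations of `gm` and `ge` on `[r₁, ∞)`
  have hgm'' : IsInvSmooth r₀'' (D + (-k₀ - 1)) gm := hgmc.mono_left h0 hr₀''₀.le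
  obtain ⟨Fm, Fm', hFm⟩ := hgm''.exists_halfLineRegularisation' h0'' hr₀''₁
  have hFe := isHalfLineRegularisation_of_norm_le (φ := ge) h0'' hr₀''₁ (le_refl (-4 : ℤ))
    (hgec.mono fun r hr => hr₀''₀.trans hr) hge_bd
  -- polynomial bounds for `gm`, `ge` on `[r₁, ∞)`
  obtain ⟨Cg, hCg⟩ := hgmc.norm_le h0
  set dg : ℤ := D + (-k₀ - 1) with hdg
  set Kb : ℕ := max dg.toNat 0 with hKb
  set Cb : ℝ := |Cg| * max 1 (r₁ ^ dg) + Ce * max 1 (r₁ ^ (-4 : ℤ)) with hCb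
  have hbd : ∀ {C₀ : ℝ} {e : ℤ} {g : ℝ → ℂ}, (∀ r, r₀'' < r → ‖g r‖ ≤ C₀ * r ^ e) → 0 ≤ C₀ →
      e.toNat ≤ Kb → ∀ r ∈ Ici r₁, ‖g r‖ ≤ C₀ * max 1 (r₁ ^ e) * (1 + r) ^ Kb := by
    intro C₀ e g hg hC₀ he r hr
    have hr' : r₁ ≤ r := mem_Ici.1 hr
    have h1 := hg r (hr₀''₁.trans_le hr')
    have h2 : r ^ e ≤ max 1 (r₁ ^ e) * (1 + r) ^ e.toNat := zpow_le_max_mul_pow hr₁0 hr' e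
    have h3 : (1 + r) ^ e.toNat ≤ (1 + r) ^ Kb := pow_le_pow_right₀ (by linarith) he
    have hm : 0 ≤ max 1 (r₁ ^ e) := le_trans zero_le_one (le_max_left _ _)
    calc ‖g r‖ ≤ C₀ * r ^ e := h1
      _ ≤ C₀ * (max 1 (r₁ ^ e) * (1 + r) ^ Kb) :=
          mul_le_mul_of_nonneg_left (h2.trans (mul_le_mul_of_nonneg_left h3 hm)) hC₀
      _ = C₀ * max 1 (r₁ ^ e) * (1 + r) ^ Kb := by ring
  have hgm_c1 : ContinuousOn gm (Ici r₁) := (hgmc.continuousOn h0).mono fun r hr => hr₀₁.trans_le hr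
  have hge_c1 : ContinuousOn ge (Ici r₁) := hgec.mono fun r hr => hr₀₁.trans_le hr
  have hgm_b : ∀ r ∈ Ici r₁, ‖gm r‖ ≤ Cb * (1 + r) ^ Kb := by
    intro r hr
    have h := hbd (g := gm) (fun r hr' => (hCg r (hr₀''₀.trans hr')).trans
      (mul_le_mul_of_nonneg_right (le_abs_self _) (zpow_nonneg (h0''.trans hr').le _)))
      (abs_nonneg _) (le_max_left _ _) r hr
    have hpos : 0 ≤ (1 + r) ^ Kb := pow_nonneg (by linarith [mem_Ici.1 hr]) _
    have : 0 ≤ Ce * max 1 (r₁ ^ (-4 : ℤ)) * (1 + r) ^ Kb :=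
      mul_nonneg (mul_nonneg hCe0 (le_trans zero_le_one (le_max_left _ _))) hpos
    rw [hCb]; linarith
  have hge_b : ∀ r ∈ Ici r₁, ‖ge r‖ ≤ Cb * (1 + r) ^ Kb := by
    intro r hr
    have h := hbd (g := ge) hge_bd hCe0 (by rw [hKb]; exact le_max_of_le_right (by norm_num)) r hr
    have hpos : 0 ≤ (1 + r) ^ Kb := pow_nonneg (by linarith [mem_Ici.1 hr]) _
    have : 0 ≤ |Cg| * max 1 (r₁ ^ dg) * (1 + r) ^ Kb :=
      mul_nonneg (mul_nonneg (abs_nonneg _) (le_trans zero_le_one (le_max_left _ _))) hpos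
    rw [hCb]; linarith
  have hFn₀ := IsHalfLineRegularisation.add hr₁0.le hFm hFe hgm_c1 hge_c1 hgm_b hge_b
  have hfn_eq : (fun r => gm r + ge r) = f n := by funext r; simp only [hge]; ring
  obtain ⟨Fn, Fn', hFnreg⟩ : ∃ Fn Fn' : ℂ → ℂ, IsHalfLineRegularisation r₁ (f n) Fn Fn' :=
    ⟨_, _, hfn_eq ▸ hFn₀⟩
  obtain ⟨hFa, -, hFb, hFb', hFcW, CF, hFdd⟩ := hFnreg
  -- the regularised far integral as a function of `λ`
  set c₁ : ℂ := ((r₁ - rMinus M a : ℝ) : ℂ) with hc₁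
  set Φl : ℂ → ℂ := fun lam => Complex.exp (lam * c₁) * ((-1) ^ n * lam ^ (-(n : ℤ)) * Fn lam)
    with hΦl
  set Φl' : ℂ → ℂ := fun lam =>
      Complex.exp (lam * c₁) * c₁ * ((-1) ^ n * lam ^ (-(n : ℤ)) * Fn lam) +
        Complex.exp (lam * c₁) * ((-1) ^ n * (((-(n : ℤ) : ℤ) : ℂ) * lam ^ (-(n : ℤ) - 1)) * Fn lam +
          (-1) ^ n * lam ^ (-(n : ℤ)) * Fn' lam) with hΦl'
  set Az : ℝ → ℝ → ℂ := fun x y => whitingA M a ω * (((x : ℂ) + I * y) - rMinus M a) with hAz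
  -- `λ`: membership in the closed half-plane, continuity, affine form
  have hAz_re : ∀ x y, (Az x y).re = -(2 * ω * y / (rPlus M a - rMinus M a)) :=
    fun x y => (whitingA_mul_re_im ha ω x y).1
  have hAz_im : ∀ x y, (Az x y).im = 2 * ω * (x - rMinus M a) / (rPlus M a - rMinus M a) :=
    fun x y => (whitingA_mul_re_im ha ω x y).2
  have hAz_ne : ∀ x y, rMinus M a < x → Az x y ≠ 0 := by
    intro x y hx h
    have h1 := hAz_im x y
    rw [h, Complex.zero_im] at h1
    have hxpos : 0 < x - rMinus M a := sub_pos.2 hx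
    rcases lt_or_gt_of_ne hω with hω' | hω'
    · have h2 : 2 * ω * (x - rMinus M a) / (rPlus M a - rMinus M a) < 0 :=
        div_neg_of_neg_of_pos (by nlinarith) hgap
      linarith
    · have h2 : 0 < 2 * ω * (x - rMinus M a) / (rPlus M a - rMinus M a) :=
        div_pos (by nlinarith) hgap
      linarith
  have hAz_mem : ∀ x y, rMinus M a < x → 0 ≤ ω * y → Az x y ∈ leftHalfPlane₀ := by
    intro x y hx hy
    refine ⟨?_, hAz_ne x y hx⟩
    rw [hAz_re]
    have : 0 ≤ 2 * ω * y / (rPlus M a - rMinus M a) := div_nonneg (by nlinarith) hgap.le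
    linarith
  have hAz_lt : ∀ x y, 0 < ω * y → (Az x y).re < 0 := by
    intro x y hy
    rw [hAz_re]
    have : 0 < 2 * ω * y / (rPlus M a - rMinus M a) := div_pos (by nlinarith) hgap
    linarith
  have hAz_aff : ∀ x y, Az x y =
      whitingA M a ω * (x : ℂ) + whitingA M a ω * (I * y - rMinus M a) := by
    intro x y; simp only [hAz]; ring
  have hAz_cy : ∀ x, Continuous fun y : ℝ => Az x y := fun x =>
    continuous_const.mul ((continuous_const.add (continuous_const.mul Complex.continuous_ofReal)).sub
      continuous_const)
  have hAz_cx : ∀ y, Continuous fun x : ℝ => Az x y := fun y =>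
    continuous_const.mul ((Complex.continuous_ofReal.add continuous_const).sub continuous_const)
  -- continuity of `Φl`, `Φl'` on the closed half-plane and the derivative within it
  have hexpc : Continuous fun lam : ℂ => Complex.exp (lam * c₁) :=
    Complex.continuous_exp.comp (continuous_id.mul continuous_const)
  have hzc : ∀ k : ℤ, ContinuousOn (fun lam : ℂ => lam ^ k) leftHalfPlane₀ := fun k lam hlam =>
    (continuousAt_zpow₀ lam k (Or.inl hlam.2)).continuousWithinAt
  have hΦlc : ContinuousOn Φl leftHalfPlane₀ := by
    simp only [hΦl]
    exact hexpc.continuousOn.mul ((continuousOn_const.mul (hzc _)).mul hFb)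
  have hΦl'c : ContinuousOn Φl' leftHalfPlane₀ := by
    simp only [hΦl']
    refine ((hexpc.continuousOn.mul continuousOn_const).mul
      ((continuousOn_const.mul (hzc _)).mul hFb)).add (hexpc.continuousOn.mul
        (((continuousOn_const.mul (continuousOn_const.mul (hzc _))).mul hFb).add
          ((continuousOn_const.mul (hzc _)).mul hFb')))
  have hΦld : ∀ lam ∈ leftHalfPlane₀, HasDerivWithinAt Φl (Φl' lam) leftHalfPlane₀ lam := by
    intro lam hlam
    have he : HasDerivAt (fun lam : ℂ => Complex.exp (lam * c₁)) (Complex.exp (lam * c₁) * c₁) lam := by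
      have h1 : HasDerivAt (fun lam : ℂ => lam * c₁) (1 * c₁) lam := (hasDerivAt_id lam).mul_const c₁
      simpa using h1.cexp
    have hz : HasDerivAt (fun lam : ℂ => lam ^ (-(n : ℤ)))
        (((-(n : ℤ) : ℤ) : ℂ) * lam ^ (-(n : ℤ) - 1)) lam :=
      hasDerivAt_zpow (-(n : ℤ)) lam (Or.inl hlam.2)
    have hF := hFcW lam hlam
    have h := he.hasDerivWithinAt.mul (((hz.const_mul ((-1 : ℂ) ^ n)).hasDerivWithinAt.mul hF))
    refine h.congr_deriv ?_
    simp only [hΦl', Pi.mul_apply]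
  -- (a) the far integral for `ωy > 0`
  have hfar_pos : ∀ x y, 0 < ω * y →
      Φl (Az x y) = whitingTransform M a ω Ψ ((x : ℂ) + I * y) := by
    intro x y hy
    set lam := Az x y with hlam_def
    have hlam : lam.re < 0 := hAz_lt x y hy
    -- restrict to `(r₁, ∞)`
    have h1 : whitingTransform M a ω Ψ ((x : ℂ) + I * y) =
        ∫ r in Ioi r₁, whitingKernel M a ω ((x : ℂ) + I * y) r * Ψ r := by
      unfold whitingTransform
      refine setIntegral_eq_of_subset_of_forall_sdiff_eq_zero measurableSet_Ioi
        (Ioi_subset_Ioi hr₁p.le) fun r hr => ?_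
      have hr1 : rPlus M a < r := hr.1
      have hr2 : ¬ r₁ < r := hr.2
      rw [hΨz r hr1 (by linarith [not_lt.1 hr2]), mul_zero]
    -- factor the kernel
    have h2 : ∀ r, whitingKernel M a ω ((x : ℂ) + I * y) r * Ψ r =
        Complex.exp (lam * c₁) * (f 0 r * Complex.exp (lam * ((r - r₁ : ℝ) : ℂ))) := by
      intro r
      rw [show Ψ r = f 0 r from (hf0 r).symm]
      unfold whitingKernel
      rw [show whitingA M a ω * ((x : ℂ) + I * y - rMinus M a) * ((r - rMinus M a : ℝ) : ℂ) =
          lam * c₁ + lam * ((r - r₁ : ℝ) : ℂ) by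
            simp only [hlam_def, hAz, hc₁]; push_cast; ring,
        Complex.exp_add]
      ring
    have h3 : (∫ r in Ioi r₁, whitingKernel M a ω ((x : ℂ) + I * y) r * Ψ r) =
        Complex.exp (lam * c₁) *
          ∫ r in Ioi r₁, f 0 r * Complex.exp (lam * ((r - r₁ : ℝ) : ℂ)) := by
      rw [← integral_const_mul]
      exact integral_congr_ae (ae_of_all _ fun r => h2 r)
    -- integrate by parts `n` times; no boundary terms
    have h4 := integral_Ioi_mul_exp_eq_ibp_iter hlam n
      (fun j hj r hr => hfd j hj r (hr₀₁.trans_le (mem_Ici.1 hr)))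
      (fun j hj => (hfc j hj).mono fun r hr => hr₀₁.trans_le (mem_Ici.1 hr))
      (fun j hj r hr => hCf j hj r hr)
    have h5 : (∑ j ∈ Finset.range n, (-1) ^ (j + 1) * f j r₁ / lam ^ (j + 1)) = 0 := by
      refine Finset.sum_eq_zero fun j hj => ?_
      rw [hfz j (Finset.mem_range.1 hj).le r₁ ⟨hr₀₁, hr₁₂⟩]
      simp
    rw [h1, h3, h4, h5, zero_add, ← hFa lam hlam]
    simp only [hΦl]
    rw [inv_pow, ← zpow_natCast lam n, ← zpow_neg]
  -- (a') the `x`-derivative for `ωy > 0`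
  have hfarD_pos : ∀ x y, 0 < ω * y → Φl' (Az x y) * whitingA M a ω =
      ∫ r in Ioi (rPlus M a), whitingKernel M a ω ((x : ℂ) + I * y) r *
        (whitingA M a ω * ((r - rMinus M a : ℝ) : ℂ)) * Ψ r := by
    intro x y hy
    have hmem : ∀ t : ℝ, Az t y ∈ leftHalfPlane₀ := fun t =>
      ⟨(hAz_lt t y hy).le, fun h => by
        have := hAz_lt t y hy; rw [h, Complex.zero_re] at this; exact lt_irrefl _ this⟩
    have h1 : HasDerivAt (fun t : ℝ => Φl (Az t y)) (Φl' (Az x y) * whitingA M a ω) x := by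
      have h := hasDerivAt_comp_affine_local (F := Φl) (F' := Φl' (Az x y)) (S := leftHalfPlane₀)
        (α := whitingA M a ω) (β := whitingA M a ω * (I * y - rMinus M a)) (x := x)
        (by rw [← hAz_aff]; exact hΦld _ (hmem x))
        (Eventually.of_forall fun t => by rw [← hAz_aff]; exact hmem t)
      refine h.congr_of_eventuallyEq (Eventually.of_forall fun t => ?_)
      show Φl (Az t y) = Φl (whitingA M a ω * (t : ℂ) + whitingA M a ω * (I * y - rMinus M a))
      rw [hAz_aff]
    have h2 := hasDerivAt_whitingTransform hM ha hy hΨc hΨb x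
    have h3 : (fun t : ℝ => Φl (Az t y)) = fun t : ℝ => whitingTransform M a ω Ψ ((t : ℂ) + I * y) :=
      funext fun t => hfar_pos t y hy
    rw [h3] at h1
    exact h1.unique h2
  -- (b) continuity in `y` at `y = 0` from the side `ωy ≥ 0`
  have hcont_y : ∀ x, rPlus M a < x →
      ContinuousWithinAt (fun y => Φl (Az x y)) {y | 0 ≤ ω * y} 0 ∧
      ContinuousWithinAt (fun y => Φl' (Az x y) * whitingA M a ω) {y | 0 ≤ ω * y} 0 := by
    intro x hx
    have hxm : rMinus M a < x := (rMinus_le_rPlus M a).trans_lt hx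
    have hmaps : MapsTo (fun y : ℝ => Az x y) {y | 0 ≤ ω * y} leftHalfPlane₀ :=
      fun y hy => hAz_mem x y hxm hy
    have h0mem : Az x 0 ∈ leftHalfPlane₀ := hAz_mem x 0 hxm (by simp)
    exact ⟨(hΦlc _ h0mem).comp (hAz_cy x).continuousWithinAt hmaps,
      ((hΦl'c _ h0mem).comp (hAz_cy x).continuousWithinAt hmaps).mul continuousWithinAt_const⟩
  -- (c) the `x`-derivative at `y = 0`
  have hderiv0 : ∀ x, rPlus M a < x →
      HasDerivAt (fun t : ℝ => Φl (Az t 0)) (Φl' (Az x 0) * whitingA M a ω) x := by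
    intro x hx
    have hxm : rMinus M a < x := (rMinus_le_rPlus M a).trans_lt hx
    have hS : ∀ᶠ t : ℝ in 𝓝 x,
        whitingA M a ω * (t : ℂ) + whitingA M a ω * (I * ((0 : ℝ) : ℂ) - rMinus M a) ∈ leftHalfPlane₀ := by
      filter_upwards [Ioi_mem_nhds hxm] with t ht
      rw [← hAz_aff]; exact hAz_mem t 0 ht (by simp)
    have h := hasDerivAt_comp_affine_local (F := Φl) (F' := Φl' (Az x 0)) (S := leftHalfPlane₀)
      (α := whitingA M a ω) (β := whitingA M a ω * (I * ((0 : ℝ) : ℂ) - rMinus M a)) (x := x)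
      (by rw [← hAz_aff]; exact hΦld _ (hAz_mem x 0 hxm (by simp))) hS
    refine h.congr_of_eventuallyEq (Eventually.of_forall fun t => ?_)
    show Φl (Az t 0) = Φl (whitingA M a ω * (t : ℂ) + whitingA M a ω * (I * ((0 : ℝ) : ℂ) - rMinus M a))
    rw [hAz_aff]
  -- (e) continuity in `x` up to `r₊`
  have hcont_x : ContinuousOn (fun x : ℝ => Φl (Az x 0)) (Ici (rPlus M a)) :=
    hΦlc.comp (hAz_cx 0).continuousOn fun x hx =>
      hAz_mem x 0 ((IsSubextremal.rMinus_lt_rPlus ha).trans_le hx) (by simp)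
  -- (d) decay at `y = 0`
  have hdecay : ∃ C X : ℝ, ∀ x, X ≤ x → ‖Φl (Az x 0)‖ ≤ C * x ^ (-(n : ℝ)) := by
    set dd : ℝ := rPlus M a - rMinus M a with hdd
    have hωpos : 0 < |ω| := abs_pos.2 hω
    refine ⟨|CF| * (dd / |ω|) ^ n, max (2 * rPlus M a) (rMinus M a + dd / (2 * |ω|)),
      fun x hx => ?_⟩
    have hx2 : 2 * rPlus M a ≤ x := (le_max_left _ _).trans hx
    have hxd : rMinus M a + dd / (2 * |ω|) ≤ x := (le_max_right _ _).trans hx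
    have hx0 : 0 < x := by linarith
    have hdpos : 0 < dd / (2 * |ω|) := by positivity
    have hxm : rMinus M a < x := by linarith
    set μ := Az x 0 with hμ_def
    have hmem : μ ∈ leftHalfPlane₀ := hAz_mem x 0 hxm (by simp)
    have hre : μ.re = 0 := by rw [hμ_def, hAz_re]; simp
    have hnorm : ‖μ‖ = 2 * |ω| / dd * (x - rMinus M a) := by
      rw [hμ_def]
      show ‖whitingA M a ω * (((x : ℂ) + I * ((0 : ℝ) : ℂ)) - rMinus M a)‖ = _
      rw [norm_mul, hAn]
      have : ((x : ℂ) + I * ((0 : ℝ) : ℂ)) - rMinus M a = ((x - rMinus M a : ℝ) : ℂ) := by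
        push_cast; ring
      rw [this, Complex.norm_real, Real.norm_eq_abs, abs_of_pos (sub_pos.2 hxm)]
    have hlam1 : 1 ≤ ‖μ‖ := by
      rw [hnorm]
      have h1 : dd / (2 * |ω|) ≤ x - rMinus M a := by linarith
      have h2 : 2 * |ω| / dd * (dd / (2 * |ω|)) = 1 := by field_simp
      calc (1 : ℝ) = 2 * |ω| / dd * (dd / (2 * |ω|)) := h2.symm
        _ ≤ 2 * |ω| / dd * (x - rMinus M a) := mul_le_mul_of_nonneg_left h1 (by positivity)
    have hlamx : |ω| / dd * x ≤ ‖μ‖ := by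
      rw [hnorm]
      have : x / 2 ≤ x - rMinus M a := by linarith [rMinus_le_rPlus M a]
      calc |ω| / dd * x = 2 * |ω| / dd * (x / 2) := by ring
        _ ≤ 2 * |ω| / dd * (x - rMinus M a) := mul_le_mul_of_nonneg_left this (by positivity)
    obtain ⟨hF1, -⟩ := hFdd μ hmem hlam1
    have hexp : ‖Complex.exp (μ * c₁)‖ = 1 := by
      rw [Complex.norm_exp, Complex.mul_re, hre]
      simp [hc₁, Complex.ofReal_im]
    have hm1 : ‖((-1 : ℂ)) ^ n‖ = 1 := by rw [norm_pow, norm_neg, norm_one, one_pow]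
    have hzpow : ‖μ ^ (-(n : ℤ))‖ ≤ (dd / |ω|) ^ n * (x ^ n)⁻¹ := by
      rw [norm_zpow, zpow_neg, zpow_natCast]
      have hpos : 0 < |ω| / dd * x := by positivity
      calc (‖μ‖ ^ n)⁻¹ ≤ ((|ω| / dd * x) ^ n)⁻¹ :=
            inv_anti₀ (pow_pos hpos n) (pow_le_pow_left₀ hpos.le hlamx n)
        _ = (dd / |ω|) ^ n * (x ^ n)⁻¹ := by rw [mul_pow, mul_inv, ← inv_pow, inv_div]
    have hΦn : ‖Φl μ‖ = ‖μ ^ (-(n : ℤ))‖ * ‖Fn μ‖ := by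
      simp only [hΦl]
      rw [norm_mul, norm_mul, norm_mul, hexp, hm1]
      ring
    rw [hΦn]
    calc ‖μ ^ (-(n : ℤ))‖ * ‖Fn μ‖ ≤ ((dd / |ω|) ^ n * (x ^ n)⁻¹) * |CF| :=
          mul_le_mul hzpow (hF1.trans (le_abs_self _)) (norm_nonneg _) (by positivity)
      _ = |CF| * (dd / |ω|) ^ n * x ^ (-(n : ℝ)) := by
          rw [Real.rpow_neg hx0.le, Real.rpow_natCast]; ring
  exact ⟨fun x y => Φl (Az x y), fun x y => Φl' (Az x y) * whitingA M a ω,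
    fun x y hy => hfar_pos x y hy, fun x y hy => hfarD_pos x y hy, hcont_y, hderiv0, hcont_x, hdecay⟩

end Costa2019

end Literature.Geometry.Lorentzian.Kerr

end
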